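import Summits.AtomisticToContinuum.FouriersLaw.Theses.VanishingNoiseTransfer
import Literature.MathematicalPhysics.KineticTheory.VelocityFlipNoise
import Summits.AtomisticToContinuum.FouriersLaw.Theorems.VanishingNoiseTransferNoiseLocalityStubFlipSteadyStateWellPosed
import Summits.AtomisticToContinuum.FouriersLaw.Theorems.VanishingNoiseTransferNoiseLocalityStubPositiveNoisyConductance
import Summits.AtomisticToContinuum.FouriersLaw.Theorems.VanishingNoiseTransferNoiseLocalityStubResponseContinuousInNoise
import Summits.AtomisticToContinuum.FouriersLaw.Theorems.VanishingNoiseTransferNoiseLocalityFeketeReductionAux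
import Summits.AtomisticToContinuum.FouriersLaw.Theorems.VanishingNoiseTransferNoiseLocalityFeketeReductionV5

/-!
# Line `fekete-transposed-uniformity` for crux `VanishingNoiseTransfer.NoiseLocality`
(stmt-AtomisticToContinuum-11975, route `route-AtomisticToContinuum-VanishingNoiseTransfer`, rank 2) — **v7** (lead c2, 2026-08-17)

**v7 (same day, lead c2): the two sign stubs of v6 are weakened to their ROBUST TAIL FORMS.**  Motivation: in weakly coupled
(`γ ≤ 0.05`), strongly anharmonic corners the flips change the response of SHORT chains by only a few per cent with no resolved sign
(an in-session probe first suggested an enhancement at `N = 2` for `pinnedChain 1 1 0.1 0.05`, `T = 40`; with honest errors — the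
per-run scatter at that sticky two-body point is ± 15 % — and the high-statistics scan j022872 it is `D_2(0) = 0.0231(4)` vs
`D_2(0.3) = 0.0224(4)`, no effect; the only flag left is a 2.4σ, +8 % enhancement at `N = 4` for `γ = 0.02`, fading by `N = 8`), so a
stub quantified over ALL `N ≥ 2` and all `ε ≤ 1` would hang on unresolvable few-body effects.  The transfer does not need the signs at
small `N` (finitely many lengths are handled by fixed-`N` continuity alone), nor exact monotonicity (a summable slack is telescoped
away), nor the noise sign at large rates:
`modulus_of_tail_monotone` (PROVED, below) takes (i) `r_{N+1}(ε) ≤ r_N(ε) + A/(N(N−1))` for `N ≥ N⋆`, `ε ∈ (0,1]` and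
(ii) `r_N(ε) ≥ r_N(0)` for `N ≥ N⋆`, `ε ∈ (0, ε⋆]`, with `N⋆, A, ε⋆` depending on the parameters and `T`, and still outputs ONE
modulus for all `N ≥ 2`.  Registered stubs v7: `stub_resistanceQuasiMonotoneInLength` (M1⋆) and
`stub_smallNoiseReducesResponseEventually` (M2⋆).  (v6's `modulus_of_monotone` / `noiseLocality_of_monotone` are landed,
`…Theorems.NoiseLocality.MonotoneReduction`, p141499, and remain the `N⋆ = 2, A = 0, ε⋆ = 1` special case.)

--- v6 text (kept for the record) ---

**RESHAPE v6 (lead c2): the line's one N-uniform load is replaced by two FIXED-`N` SIGN CONDITIONS.**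
v5 (lead c1) left `NoiseLocality ⇐ 4a ∧ 4b` with 4a `stub_seriesLawAtZero` = the open sibling cruxes stmt-14041 ∧ stmt-11748
and 4b `stub_matthiessenExtensivity` crux-sized (both N-UNIFORM statements about the open deterministic chain; that reduction is
LANDED, `FeketeReduction.noiseLocality_of_zero_of_extensivity`, p134698, and stays available — `NoiseLocality_of_fekete` below).
v6 observes that the transposed table `r_N(ε) := 1/D_N(ε)` needs NO series law and NO `N`-uniform constant at all:

* **`modulus_of_monotone`** (PROVED here, pure real analysis, ~90 lines): if each `r_N` is continuous on `[0,1]` (LANDED stub 2),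
  `r_N(ε)` is NONINCREASING IN THE LENGTH `N` at every `ε ∈ (0,1]`, `r_N(ε) ≥ r_N(0)` for `ε ∈ (0,1]`, and `r_N(0) ≥ 0` (LANDED
  stub 3), then `w(ε) := sup_N (r_N(ε) − r_N(0)) → 0` as `ε ↓ 0` — ONE modulus for all `N`.  Proof: given `η`, choose `N₀` with
  `r_{N₀}(0) < inf_N r_N(0) + η/4`; continuity of `r_2, …, r_{N₀}` at `0` handles `N ≤ N₀`; for `N > N₀`,
  `r_N(ε) ≤ r_{N₀}(ε) < inf + η/2 ≤ r_N(0) + η/2`.  No limit `N → ∞`, no Fekete, no rate: the `N`-uniformity is produced by the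
  infimum.  (The existence half of Fourier's law that the crux carries — Disproof §5 `cauchySeq_inv_of_localityShape` — is here the
  triviality "a monotone bounded sequence converges".)
* Hence the crux follows from TWO REGISTERED STUBS, each a comparison of finitely many finite systems (no `N → ∞`, no constant):
  - `stub_responseMonotoneInLength` (M1): at every flip rate `ε ∈ (0,1]`, `D_{N+1}(ε) ≥ D_N(ε)` (`N ≥ 2`) — the linear-response
    total current does not decrease when a site is added ("the contact resistance is nonnegative": `R_{N+1} − R_N ≤ R_N/(N−1)`).
  - `stub_flipsReduceResponse` (M2): `D_N(ε) ≤ D_N(0)` for `N ≥ 2`, `ε ∈ (0,1]` — velocity flips never increase the finite-`N`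
    response (Matthiessen's sign; it is EXACTLY the crux's data at one `N` with conclusion `Dε ≤ D0`, and gives the lower half
    `r_N(ε) − r_N(0) ≥ 0 ≥ −w(ε)` of the crux for free).
  Both hold with room in the pinned HARMONIC corner for all `(ω₂, γ) ∈ {0.01,…,25} × {0.01,…,100}`, `N ≤ 12`, `ε ∈ [0,1]` (exact
  Lyapunov solve, this session, `numerics/harmonic_exact.py`, which also reproduces Disproof §6's table to 5 digits), and at the
  anharmonic points tested by leads c0/c1 (Matthiessen slopes `> 0`, `D_N(0)` increasing); the NEMD jobs of this cycle test them at
  the diffusive point, the crossover point and 48 parameter corners (small `N`, where a violation would live).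
  Why they might fail: (M1) ⟺ nonnegative effective contact resistance at every length — conceivable violation at `N = 2 → 3` in an
  overdamped/strongly anharmonic corner; (M2) — noise-ENHANCED transport is known only for disordered/localised bulks (not this
  homogeneous chain), but there is no variational principle for the non-reversible dynamics, so no proof idea either.  Fallbacks
  (crux-sized, N-uniform): upper half ⇐ ε-uniform quasi-SUBadditivity (half of v5's stub 4); lower half ⇐ ε-uniform junction
  SUPERadditivity (= S1 of the sibling crux stmt-11976's line).

COMPOSITION `NoiseLocality_of (hM1) (hM2)` (sorry-free apart from the two stubs): canonical flip-steady families and responses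
`Dc N : ℝ → ℝ` (continuous on `[0,1]`, positive for `N ≥ 2`, identified with the response of every unique family) from the LANDED
stubs 1–3 (`canonical_of_three`); `modulus_of_monotone` at `r N ε := (Dc N ε)⁻¹`; then the crux's own `μ0, με, D0, Dε` are
identified with the canonical ones by uniqueness of limits along `𝓝[≠] 0` (`N ≥ 2`, weighted form kept — Disproof §4
`additive_form_fails_ballistic`), and `N ≤ 1` is currentless (Disproof §1).

Disproof used: `Cruxes/NoiseLocality/Disproof.lean` v4 (tree copy read 2026-08-17T04Z): no `_false_without_` theorem, no `-- Targets`
verdict on any stub; §4 `pointwise_modulus_insufficient` honoured (ONE `w` for all `N`: the sup); §4 `localityShape_ballistic`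
consistent ((M1),(M2) hold in the ballistic corner, `r_N(0) → 0` allowed, no finiteness of `κ₀` produced); §5b road map: (M1) gives
parts (i) existence of `lim r_N(0)` and (iii)+(iv) by Dini-free monotone bookkeeping, (M2) gives the lower semicontinuity at `0`.
-/

noncomputable section

namespace Summit.AtomisticToContinuum.FouriersLaw.Cruxes.NoiseLocality.FeketeTransposedUniformity

open Filter Topology MeasureTheory
open Literature.MathematicalPhysics.KineticTheory.HeatConduction

/-! ## Registered stubs (v6)

Shape (D-0027 §3.3): each stub is a sorried theorem `Holds.stub_<name> : <full statement> := by sorry` — `ledger skeleton check`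
registers it under `stub_<name>` with THAT header text as signature — plus the by-name handle
`def stub_<name> : Prop := type_of% Holds.stub_<name>` used as hypothesis of `NoiseLocality_of`.  Statements are over tree
declarations only (`pinnedChain`, `IsFlipSteadyState`, `IsSteadyState`, `totalCurrent`), fully qualified, so that a
`propose --supports stmt-AtomisticToContinuum-11975` file can restate them verbatim. -/

/-- **Stub M1⋆ — `stub_resistanceQuasiMonotoneInLength` (tail of lengths `N ≥ N⋆`, summable slack; size L–XL; NEW).**
For `pinnedChain ω₂ lam β γ` (all `> 0`) and `T > 0` there are a threshold `N⋆` and a constant `A` such that for every `N ≥ N⋆`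
(`N ≥ 2`), every flip rate `ε ∈ (0,1]`, THE unique weak flip-steady families `μ` at length `N` and `μ'` at length `N + 1` and
their linear-response coefficients `D`, `D'` at `T`: `1/D' ≤ 1/D + A/(N(N−1))` — the per-bond resistance `r_N = 1/D_N` is
nonincreasing in the length up to a summable slack, uniformly in the rate ("no growing resistance deficit"; exact monotonicity,
`A = 0`, is nonnegative contact resistance, true in the pinned harmonic corner by the Lyapunov solve and in every kinetic/Landauer
picture, `D_N = Σ_k a_k (N−1)/(N−1+ℓ_k)` increasing; the slack absorbs a bounded negative contact correction and any finite-size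
correction `o(1)` of `R_N − ρ(N−1)`).  Why it might fail: a regime where `R_N(ε) − ρ_ε (N−1) → −∞` (scale-free resistance DEFICIT of
finite chains, as in momentum-conserving anomalous chains — excluded here by the pinning, but unproved). -/
theorem Holds.stub_resistanceQuasiMonotoneInLength :
    ∀ ω₂ lam β γ : ℝ, 0 < ω₂ → 0 < lam → 0 < β → 0 < γ → ∀ T : ℝ, 0 < T →
    ∃ (Nstar : ℕ) (A : ℝ), ∀ (N : ℕ), Nstar ≤ N → 2 ≤ N → ∀ ε : ℝ, 0 < ε → ε ≤ 1 →
    ∀ μ : ℝ → ℝ →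
        MeasureTheory.Measure (Literature.MathematicalPhysics.KineticTheory.HeatConduction.PhaseSpace N),
      (∀ T_L T_R : ℝ, 0 < T_L → 0 < T_R →
        (Literature.MathematicalPhysics.KineticTheory.HeatConduction.pinnedChain ω₂ lam β γ).IsFlipSteadyState
            N T_L T_R ε (μ T_L T_R) ∧
          ∀ ν : MeasureTheory.Measure (Literature.MathematicalPhysics.KineticTheory.HeatConduction.PhaseSpace N),
            (Literature.MathematicalPhysics.KineticTheory.HeatConduction.pinnedChain ω₂ lam β γ).IsFlipSteadyState
              N T_L T_R ε ν → ν = μ T_L T_R) →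
    ∀ μ' : ℝ → ℝ →
        MeasureTheory.Measure (Literature.MathematicalPhysics.KineticTheory.HeatConduction.PhaseSpace (N + 1)),
      (∀ T_L T_R : ℝ, 0 < T_L → 0 < T_R →
        (Literature.MathematicalPhysics.KineticTheory.HeatConduction.pinnedChain ω₂ lam β γ).IsFlipSteadyState
            (N + 1) T_L T_R ε (μ' T_L T_R) ∧
          ∀ ν : MeasureTheory.Measure (Literature.MathematicalPhysics.KineticTheory.HeatConduction.PhaseSpace (N + 1)),
            (Literature.MathematicalPhysics.KineticTheory.HeatConduction.pinnedChain ω₂ lam β γ).IsFlipSteadyState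
              (N + 1) T_L T_R ε ν → ν = μ' T_L T_R) →
    ∀ D D' : ℝ,
      Filter.Tendsto (fun δ : ℝ =>
          (Literature.MathematicalPhysics.KineticTheory.HeatConduction.pinnedChain ω₂ lam β γ).totalCurrent
            (μ (T + δ / 2) (T - δ / 2)) / δ) (nhdsWithin 0 {(0 : ℝ)}ᶜ) (nhds D) →
      Filter.Tendsto (fun δ : ℝ =>
          (Literature.MathematicalPhysics.KineticTheory.HeatConduction.pinnedChain ω₂ lam β γ).totalCurrent
            (μ' (T + δ / 2) (T - δ / 2)) / δ) (nhdsWithin 0 {(0 : ℝ)}ᶜ) (nhds D') →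
      D'⁻¹ ≤ D⁻¹ + A / ((N : ℝ) * ((N : ℝ) - 1)) := by
  sorry

/-- **Stub M2⋆ — `stub_smallNoiseReducesResponseEventually` (tail of lengths, small rates; size L–XL; NEW).**  For
`pinnedChain ω₂ lam β γ` (all `> 0`) and `T > 0` there are `N⋆` and `ε⋆ > 0` such that for every `N ≥ N⋆` (`N ≥ 2`), every
`ε ∈ (0, ε⋆]`, THE unique weak steady family `μ0` (`IsSteadyState`) and THE unique flip-steady family `με` at rate `ε`, both at
length `N`, and their response coefficients `D0`, `Dε` at `T`: `Dε ≤ D0` — SMALL velocity-flip noise never increases the response of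
LONG chains (the sign of Matthiessen's rule; the binders are exactly the crux's at one `N`).  v6 asked this for all `N ≥ 2`,
`ε ≤ 1`; at weak coupling (`γ ≤ 0.05`) and strong anharmonicity the flips change `D_N` of SHORT chains by ≤ 10 % with no resolved
sign (j022872: one 2.4σ enhancement flag, `pinnedChain 1 1 0.1 0.02`, `T = 40`, `N = 4`, fading by `N = 8`), so only the tail form is
asserted.  NUMERICS (lead c2, jobs j022723/j022724, production 1 %): `D_N(ε) < D_N(0)` at EVERY `N ≤ 128`, `ε ∈ [.05, 1]` at
`(1,1,0.1,1), T = 8` and `(1,1,1,1), T = 1`, with the Matthiessen slope `(1/D_N(ε) − 1/D_N(0))/ε` N-UNIFORM: `9.5 ± 1.5` resp.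
`5.5 ± 0.2` (`N ≥ 16`) — the crux's modulus made visible.  TRUE exactly in the pinned harmonic corner (every `N`, every `ε`).  Why it
might fail: dephasing-ASSISTED (Förster-type) hopping between thermally detuned strongly anharmonic sites could make
`∂_ε D_N(0) > 0` in the bulk at high `T·lam` — not seen in any of the 64 corners scanned (`T ≤ 40`, `N ≤ 8`). -/
theorem Holds.stub_smallNoiseReducesResponseEventually :
    ∀ ω₂ lam β γ : ℝ, 0 < ω₂ → 0 < lam → 0 < β → 0 < γ → ∀ T : ℝ, 0 < T →
    ∃ (Nstar : ℕ) (ε₀ : ℝ), 0 < ε₀ ∧ ∀ (N : ℕ), Nstar ≤ N → 2 ≤ N → ∀ ε : ℝ, 0 < ε → ε ≤ ε₀ →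
    ∀ μ0 : ℝ → ℝ →
        MeasureTheory.Measure (Literature.MathematicalPhysics.KineticTheory.HeatConduction.PhaseSpace N),
      (∀ T_L T_R : ℝ, 0 < T_L → 0 < T_R →
        (Literature.MathematicalPhysics.KineticTheory.HeatConduction.pinnedChain ω₂ lam β γ).IsSteadyState
            N T_L T_R (μ0 T_L T_R) ∧
          ∀ ν : MeasureTheory.Measure (Literature.MathematicalPhysics.KineticTheory.HeatConduction.PhaseSpace N),
            (Literature.MathematicalPhysics.KineticTheory.HeatConduction.pinnedChain ω₂ lam β γ).IsSteadyState
              N T_L T_R ν → ν = μ0 T_L T_R) →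
    ∀ με : ℝ → ℝ →
        MeasureTheory.Measure (Literature.MathematicalPhysics.KineticTheory.HeatConduction.PhaseSpace N),
      (∀ T_L T_R : ℝ, 0 < T_L → 0 < T_R →
        (Literature.MathematicalPhysics.KineticTheory.HeatConduction.pinnedChain ω₂ lam β γ).IsFlipSteadyState
            N T_L T_R ε (με T_L T_R) ∧
          ∀ ν : MeasureTheory.Measure (Literature.MathematicalPhysics.KineticTheory.HeatConduction.PhaseSpace N),
            (Literature.MathematicalPhysics.KineticTheory.HeatConduction.pinnedChain ω₂ lam β γ).IsFlipSteadyState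
              N T_L T_R ε ν → ν = με T_L T_R) →
    ∀ D0 Dε : ℝ,
      Filter.Tendsto (fun δ : ℝ =>
          (Literature.MathematicalPhysics.KineticTheory.HeatConduction.pinnedChain ω₂ lam β γ).totalCurrent
            (μ0 (T + δ / 2) (T - δ / 2)) / δ) (nhdsWithin 0 {(0 : ℝ)}ᶜ) (nhds D0) →
      Filter.Tendsto (fun δ : ℝ =>
          (Literature.MathematicalPhysics.KineticTheory.HeatConduction.pinnedChain ω₂ lam β γ).totalCurrent
            (με (T + δ / 2) (T - δ / 2)) / δ) (nhdsWithin 0 {(0 : ℝ)}ᶜ) (nhds Dε) →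
      Dε ≤ D0 := by
  sorry

/-- Statement of registered stub M1⋆ (`Holds.stub_resistanceQuasiMonotoneInLength`), by name. -/
def stub_resistanceQuasiMonotoneInLength : Prop := type_of% Holds.stub_resistanceQuasiMonotoneInLength
/-- Statement of registered stub M2⋆ (`Holds.stub_smallNoiseReducesResponseEventually`), by name. -/
def stub_smallNoiseReducesResponseEventually : Prop := type_of% Holds.stub_smallNoiseReducesResponseEventually

/-! ## The transfer (PROVED, v7): tail quasi-monotone in the length + small-noise sign + fixed-`N` continuity ⇒ ONE modulus -/

/-- **Tail-monotone transfer.** Let `r N : ℝ → ℝ` (`N ≥ 2`) be continuous on `[0,1]` and nonnegative there. Suppose that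
on a tail `N ≥ N⋆` (i) `r (N+1) ε ≤ r N ε + A/(N(N−1))` for every `ε ∈ (0,1]` (almost nonincreasing in the length, summable
slack) and (ii) `r N 0 ≤ r N ε` for `ε ∈ (0, ε⋆]` (small noise does not lower the value). Then there is ONE modulus `w → 0`
at `0⁺` with `|r N ε − r N 0| ≤ w ε` for ALL `N ≥ 2` and `ε ∈ (0,1]`. Proof: `w ε := sup_N |r N ε − r N 0|`; the finitely
many `N` below a large `N₀` are handled by fixed-`N` continuity; `N₀` is chosen on the tail near the liminf of `N ↦ r N 0`
with slack `≤ η/8`, and for `N > N₀`, `r N ε ≤ r N₀ ε + η/8 < r N₀ 0 + η/4 < liminf + 3η/8 < r N 0 + η/2`, while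
`r N ε ≥ r N 0` by (ii). [folklore] -/
theorem modulus_of_tail_monotone :
    ∀ (r : ℕ → ℝ → ℝ) (A ε₀ : ℝ) (Nstar : ℕ), 0 < ε₀ →
      (∀ N : ℕ, 2 ≤ N → ContinuousOn (r N) (Set.Icc 0 1)) →
      (∀ N : ℕ, 2 ≤ N → ∀ ε : ℝ, 0 ≤ ε → ε ≤ 1 → 0 ≤ r N ε) →
      (∀ N : ℕ, Nstar ≤ N → 2 ≤ N → ∀ ε : ℝ, 0 < ε → ε ≤ 1 →
        r (N + 1) ε ≤ r N ε + A / ((N : ℝ) * ((N : ℝ) - 1))) →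
      (∀ N : ℕ, Nstar ≤ N → 2 ≤ N → ∀ ε : ℝ, 0 < ε → ε ≤ ε₀ → r N 0 ≤ r N ε) →
      ∃ w : ℝ → ℝ, Filter.Tendsto w (nhdsWithin 0 (Set.Ioi 0)) (nhds 0) ∧
        ∀ N : ℕ, 2 ≤ N → ∀ ε : ℝ, 0 < ε → ε ≤ 1 → |r N ε - r N 0| ≤ w ε := by
  intro r A ε₀ Nstar hε₀ hcont hpos hmono hnoise
  set B : ℝ := max A 0 with hB
  have hB0 : 0 ≤ B := le_max_right _ _
  have hAB : A ≤ B := le_max_left _ _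
  -- the threshold `M = max N⋆ 2`
  set M : ℕ := max Nstar 2 with hM
  have hM2 : 2 ≤ M := le_max_right _ _
  have hMs : Nstar ≤ M := le_max_left _ _
  -- telescoped slack monotonicity on the tail
  have hchain : ∀ ε : ℝ, 0 < ε → ε ≤ 1 → ∀ N : ℕ, M ≤ N → ∀ K : ℕ, N ≤ K →
      r K ε ≤ r N ε + B * (1 / ((N : ℝ) - 1) - 1 / ((K : ℝ) - 1)) := by
    intro ε hε hε1 N hN K hNK
    induction K, hNK using Nat.le_induction with
    | base => simp
    | succ K hNK ih =>
      have hK2 : 2 ≤ K := hM2.trans (hN.trans hNK)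
      have hKs : Nstar ≤ K := hMs.trans (hN.trans hNK)
      have hK1 : (0 : ℝ) < (K : ℝ) - 1 := by
        have : (2 : ℝ) ≤ K := by exact_mod_cast hK2
        linarith
      have hK0 : (0 : ℝ) < (K : ℝ) := by linarith
      have step := hmono K hKs hK2 ε hε hε1
      have hslack : A / ((K : ℝ) * ((K : ℝ) - 1)) ≤ B / ((K : ℝ) * ((K : ℝ) - 1)) :=
        div_le_div_of_nonneg_right hAB (mul_pos hK0 hK1).le
      have e : B / ((K : ℝ) * ((K : ℝ) - 1)) = B * (1 / ((K : ℝ) - 1) - 1 / (((K + 1 : ℕ) : ℝ) - 1)) := by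
        have hK1' : (K : ℝ) - 1 ≠ 0 := hK1.ne'
        have hK0' : (K : ℝ) ≠ 0 := hK0.ne'
        push_cast
        rw [add_sub_cancel_right]
        field_simp
        ring
      rw [e] at hslack
      nlinarith [step, hslack, ih]
  have hchain' : ∀ ε : ℝ, 0 < ε → ε ≤ 1 → ∀ N : ℕ, M ≤ N → ∀ K : ℕ, N ≤ K →
      r K ε ≤ r N ε + B / ((N : ℝ) - 1) := by
    intro ε hε hε1 N hN K hNK
    have h := hchain ε hε hε1 N hN K hNK
    have hK1 : (0 : ℝ) < (K : ℝ) - 1 := by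
      have : (2 : ℝ) ≤ K := by exact_mod_cast (hM2.trans (hN.trans hNK))
      linarith
    have : 0 ≤ B * (1 / ((K : ℝ) - 1)) := mul_nonneg hB0 (by positivity)
    have e : B * (1 / ((N : ℝ) - 1) - 1 / ((K : ℝ) - 1)) = B / ((N : ℝ) - 1) - B * (1 / ((K : ℝ) - 1)) := by ring
    linarith
  -- transfer of limits from `𝓝[Icc 0 1] 0` to `𝓝[>] 0`
  have to_right : ∀ {f : ℝ → ℝ} {a : ℝ}, Tendsto f (𝓝[Set.Icc (0 : ℝ) 1] 0) (𝓝 a) →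
      Tendsto f (𝓝[>] (0 : ℝ)) (𝓝 a) := by
    intro f a h
    have h' := h.mono_left (nhdsWithin_mono (0 : ℝ) (Set.Ioc_subset_Icc_self (a := (0 : ℝ)) (b := 1)))
    rwa [nhdsWithin_Ioc_eq_nhdsGT zero_lt_one] at h'
  have h0mem : (0 : ℝ) ∈ Set.Icc (0 : ℝ) 1 := ⟨le_rfl, zero_le_one⟩
  have h2ev : ∀ᶠ ε in 𝓝[>] (0 : ℝ), ε ≤ 1 := mem_nhdsWithin_of_mem_nhds (Iic_mem_nhds one_pos)
  have h3ev : ∀ᶠ ε in 𝓝[>] (0 : ℝ), 0 < ε := self_mem_nhdsWithin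
  have h4ev : ∀ᶠ ε in 𝓝[>] (0 : ℝ), ε ≤ ε₀ := mem_nhdsWithin_of_mem_nhds (Iic_mem_nhds hε₀)
  -- the slack bound passes to `ε = 0` on the tail: `r K 0 ≤ r M 0 + B`
  have hM1pos : (0 : ℝ) < (M : ℝ) - 1 := by
    have : (2 : ℝ) ≤ M := by exact_mod_cast hM2
    linarith
  have hBM : B / ((M : ℝ) - 1) ≤ B := by
    rw [div_le_iff₀ hM1pos]
    have : (2 : ℝ) ≤ M := by exact_mod_cast hM2
    nlinarith
  have hzero : ∀ K : ℕ, M ≤ K → r K 0 ≤ r M 0 + B := by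
    intro K hK
    have hl : Tendsto (r K) (𝓝[>] (0 : ℝ)) (𝓝 (r K 0)) := to_right (hcont K (hM2.trans hK) 0 h0mem)
    have hr : Tendsto (fun ε => r M ε + B) (𝓝[>] (0 : ℝ)) (𝓝 (r M 0 + B)) :=
      (to_right (hcont M hM2 0 h0mem)).add_const B
    refine le_of_tendsto_of_tendsto hl hr ?_
    filter_upwards [h2ev, h3ev] with ε hε1 hε
    have := hchain' ε hε hε1 M le_rfl K hK
    linarith
  -- the discrepancy table (absolute values), indexed from `N = 2`
  set g : ℝ → ℕ → ℝ := fun ε n => |r (n + 2) ε - r (n + 2) 0| with hg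
  have g_nonneg : ∀ ε n, 0 ≤ g ε n := fun ε n => abs_nonneg _
  have g_tail_le : ∀ ε : ℝ, 0 < ε → ε ≤ 1 → ∀ n, M ≤ n + 2 → g ε n ≤ r M ε + r M 0 + 2 * B := by
    intro ε hε hε1 n hn
    have h1 := hchain' ε hε hε1 M le_rfl (n + 2) hn
    have h2 := hzero (n + 2) hn
    have h3 : 0 ≤ r (n + 2) ε := hpos (n + 2) (by omega) ε hε.le hε1
    have h4 : 0 ≤ r (n + 2) 0 := hpos (n + 2) (by omega) 0 le_rfl zero_le_one
    have h5 : 0 ≤ r M ε := hpos M hM2 ε hε.le hε1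
    have h6 : 0 ≤ r M 0 := hpos M hM2 0 le_rfl zero_le_one
    simp only [hg]
    rw [abs_le]
    constructor <;> linarith
  have hbdd : ∀ ε : ℝ, 0 < ε → ε ≤ 1 → BddAbove (Set.range (g ε)) := by
    intro ε hε hε1
    have hfin : BddAbove ((g ε) '' Set.Iio M) := ((Set.finite_Iio M).image _).bddAbove
    have htail : BddAbove ((g ε) '' Set.Ici M) :=
      ⟨r M ε + r M 0 + 2 * B, by
        rintro _ ⟨n, hn, rfl⟩
        exact g_tail_le ε hε hε1 n (le_trans hn (Nat.le_add_right n 2))⟩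
    refine (hfin.union htail).mono ?_
    rintro _ ⟨n, rfl⟩
    rcases lt_or_ge n M with hn | hn
    · exact Or.inl ⟨n, hn, rfl⟩
    · exact Or.inr ⟨n, hn, rfl⟩
  -- tail infima `t k := inf_n r (n + k + M) 0` and their supremum `L` (the liminf of `N ↦ r N 0`)
  have hbb : ∀ k : ℕ, BddBelow (Set.range fun n : ℕ => r (n + k + M) 0) := fun k =>
    ⟨0, by rintro _ ⟨n, rfl⟩; exact hpos (n + k + M) (by omega) 0 le_rfl zero_le_one⟩
  set t : ℕ → ℝ := fun k => ⨅ n : ℕ, r (n + k + M) 0 with ht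
  have ht_le : ∀ k n : ℕ, t k ≤ r (n + k + M) 0 := fun k n => ciInf_le (hbb k) n
  have ht_bdd : BddAbove (Set.range t) := by
    refine ⟨r M 0 + B, ?_⟩
    rintro _ ⟨k, rfl⟩
    exact (ht_le k 0).trans (hzero (0 + k + M) (by omega))
  set L : ℝ := ⨆ k : ℕ, t k with hL
  have hL_ge : ∀ k, t k ≤ L := fun k => le_ciSup ht_bdd k
  refine ⟨fun ε => ⨆ n, g ε n, ?_, ?_⟩
  · -- the modulus tends to `0`
    refine Metric.tendsto_nhds.mpr fun η hη => ?_
    obtain ⟨k₁, hk₁⟩ : ∃ k₁ : ℕ, L - η / 8 < t k₁ := exists_lt_of_lt_ciSup (by linarith)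
    obtain ⟨K, hK⟩ := exists_nat_gt (8 * B / η)
    set k₂ : ℕ := max k₁ K with hk₂
    have htk₂ : t k₂ < L + η / 8 := by linarith [hL_ge k₂]
    obtain ⟨n₀, hn₀⟩ : ∃ n₀ : ℕ, r (n₀ + k₂ + M) 0 < L + η / 8 := exists_lt_of_ciInf_lt htk₂
    set N₀ : ℕ := n₀ + k₂ + M with hN₀
    have hN₀M : M ≤ N₀ := by omega
    have hN₀2 : 2 ≤ N₀ := hM2.trans hN₀M
    have hslack : B / ((N₀ : ℝ) - 1) ≤ η / 8 := by
      have hN₀1 : (0 : ℝ) < (N₀ : ℝ) - 1 := by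
        have : (2 : ℝ) ≤ N₀ := by exact_mod_cast hN₀2
        linarith
      rw [div_le_iff₀ hN₀1]
      have hKle : (K : ℝ) ≤ (N₀ : ℝ) - 1 := by
        have : K + 1 ≤ N₀ := by omega
        have : ((K + 1 : ℕ) : ℝ) ≤ N₀ := by exact_mod_cast this
        push_cast at this
        linarith
      rw [div_lt_iff₀ hη] at hK
      nlinarith
    -- continuity at `0` of the finitely many `r 2, …, r (N₀ + 2)` (absolute form) and of `r N₀` (one-sided form)
    have hf : ∀ᶠ ε in 𝓝[>] (0 : ℝ), ∀ n ∈ Finset.range (N₀ + 1), g ε n < η / 8 := by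
      refine (eventually_all_finset _).mpr fun n _ => ?_
      have hr : Tendsto (r (n + 2)) (𝓝[>] (0 : ℝ)) (𝓝 (r (n + 2) 0)) :=
        to_right (hcont (n + 2) (by omega) 0 h0mem)
      have h0 : Tendsto (fun ε => g ε n) (𝓝[>] 0) (𝓝 0) := by
        have := (hr.sub_const (r (n + 2) 0)).abs
        simpa [hg] using this
      have := (Metric.tendsto_nhds.mp h0) (η / 8) (by positivity)
      simpa only [Real.dist_eq, sub_zero, abs_of_nonneg (g_nonneg _ n)] using this
    have hf0 : ∀ᶠ ε in 𝓝[>] (0 : ℝ), r N₀ ε < r N₀ 0 + η / 8 := by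
      have hr : Tendsto (r N₀) (𝓝[>] (0 : ℝ)) (𝓝 (r N₀ 0)) := to_right (hcont N₀ hN₀2 0 h0mem)
      exact hr.eventually (gt_mem_nhds (by linarith))
    filter_upwards [hf, hf0, h2ev, h3ev, h4ev] with ε hfε hf0ε hε1 hε hεε₀
    have hall : ∀ n, g ε n ≤ η / 2 := by
      intro n
      rcases le_or_gt (n + 2) (N₀ + 2) with hn | hn
      · exact (hfε n (Finset.mem_range.mpr (by omega))).le.trans (by linarith)
      · -- `N = n + 2 > N₀ + 2`: slack chain from `N₀`, smallness at `N₀`, tail lower bound, noise sign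
        have hnM : M ≤ n + 2 := by omega
        have a : r (n + 2) ε ≤ r N₀ ε + B / ((N₀ : ℝ) - 1) := hchain' ε hε hε1 N₀ hN₀M (n + 2) (by omega)
        have c : L - η / 8 < r (n + 2) 0 := by
          have h1 : t k₁ ≤ r ((n + 2 - k₁ - M) + k₁ + M) 0 := ht_le k₁ (n + 2 - k₁ - M)
          have e : n + 2 - k₁ - M + k₁ + M = n + 2 := by
            have : k₁ ≤ k₂ := le_max_left _ _
            omega
          rw [e] at h1
          linarith
        have d : r (n + 2) 0 ≤ r (n + 2) ε :=
          hnoise (n + 2) (hMs.trans hnM) (hM2.trans hnM) ε hε hεε₀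
        simp only [hg]
        rw [abs_le]
        constructor <;> linarith
    have hsup : (⨆ n, g ε n) ≤ η / 2 := ciSup_le hall
    have hsup0 : 0 ≤ ⨆ n, g ε n := le_ciSup_of_le (hbdd ε hε hε1) 0 (g_nonneg ε 0)
    rw [Real.dist_eq, sub_zero, abs_of_nonneg hsup0]
    linarith
  · -- the bound itself
    intro N hN ε hε hε1
    obtain ⟨n, rfl⟩ : ∃ n, N = n + 2 := ⟨N - 2, by omega⟩
    exact le_ciSup (hbdd ε hε hε1) n

/-! ## Canonical families and responses from the LANDED stubs 1–3 (proved) -/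

/-- **Landed stubs 1–3 ⇒ canonical unique flip-steady families `μc N ε` (`ε ∈ [0,1]`) and canonical responses `Dc N : ℝ → ℝ`,
continuous on `[0,1]`, positive for `N ≥ 2`, and equal to the response of EVERY unique flip-steady family at rate `ε`.**
(Steps (0)–(2) of `FeketeReduction.canonical_of_stubs`, without any series law.) [folklore] -/
theorem canonical_of_three {ω₂ lam β γ : ℝ} (hω : 0 < ω₂) (hl : 0 < lam) (hβ : 0 < β) (hγ : 0 < γ) {T : ℝ}
    (hT : 0 < T) :
    ∃ (μc : (N : ℕ) → ℝ → ℝ → ℝ → Measure (PhaseSpace N)) (Dc : ℕ → ℝ → ℝ),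
      (∀ (N : ℕ) (ε : ℝ), 0 ≤ ε → ε ≤ 1 → ∀ T_L T_R : ℝ, 0 < T_L → 0 < T_R →
        (pinnedChain ω₂ lam β γ).IsFlipSteadyState N T_L T_R ε (μc N ε T_L T_R) ∧
          ∀ ν : Measure (PhaseSpace N),
            (pinnedChain ω₂ lam β γ).IsFlipSteadyState N T_L T_R ε ν → ν = μc N ε T_L T_R) ∧
      (∀ N : ℕ, ContinuousOn (Dc N) (Set.Icc 0 1)) ∧
      (∀ N : ℕ, 2 ≤ N → ∀ ε : ℝ, 0 ≤ ε → ε ≤ 1 → 0 < Dc N ε) ∧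
      (∀ (N : ℕ) (ε : ℝ), 0 ≤ ε → ε ≤ 1 →
        ∀ μ : ℝ → ℝ → Measure (PhaseSpace N),
          (∀ T_L T_R : ℝ, 0 < T_L → 0 < T_R →
            (pinnedChain ω₂ lam β γ).IsFlipSteadyState N T_L T_R ε (μ T_L T_R) ∧
              ∀ ν : Measure (PhaseSpace N),
                (pinnedChain ω₂ lam β γ).IsFlipSteadyState N T_L T_R ε ν → ν = μ T_L T_R) →
          Tendsto (fun δ : ℝ =>
            (pinnedChain ω₂ lam β γ).totalCurrent (μ (T + δ / 2) (T - δ / 2)) / δ) (𝓝[≠] 0)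
            (𝓝 (Dc N ε))) := by
  -- (0) the canonical flip-steady family (landed stub 1 + choice; junk outside the box)
  have hex : ∀ (N : ℕ) (ε T_L T_R : ℝ), ∃ μ : Measure (PhaseSpace N),
      (0 ≤ ε → ε ≤ 1 → 0 < T_L → 0 < T_R →
        (pinnedChain ω₂ lam β γ).IsFlipSteadyState N T_L T_R ε μ ∧
          ∀ ν : Measure (PhaseSpace N),
            (pinnedChain ω₂ lam β γ).IsFlipSteadyState N T_L T_R ε ν → ν = μ) := by
    intro N ε T_L T_R
    by_cases h : 0 ≤ ε ∧ ε ≤ 1 ∧ 0 < T_L ∧ 0 < T_R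
    · obtain ⟨μ, hμ⟩ :=
        Summit.AtomisticToContinuum.FouriersLaw.Theorems.NoiseLocality.stub_flipSteadyStateWellPosed
          ω₂ lam β γ hω hl hβ hγ N ε h.1 h.2.1 T_L T_R h.2.2.1 h.2.2.2
      exact ⟨μ, fun _ _ _ _ => hμ⟩
    · exact ⟨0, fun h0 h1' hL hR => (h ⟨h0, h1', hL, hR⟩).elim⟩
  choose μc hμc using hex
  have hfam : ∀ (N : ℕ) (ε : ℝ), 0 ≤ ε → ε ≤ 1 → ∀ T_L T_R : ℝ, 0 < T_L → 0 < T_R →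
      (pinnedChain ω₂ lam β γ).IsFlipSteadyState N T_L T_R ε (μc N ε T_L T_R) ∧
        ∀ ν : Measure (PhaseSpace N),
          (pinnedChain ω₂ lam β γ).IsFlipSteadyState N T_L T_R ε ν → ν = μc N ε T_L T_R :=
    fun N ε h0 h1' T_L T_R hL hR => hμc N ε T_L T_R h0 h1' hL hR
  -- (1) canonical responses, continuous on `[0,1]` (landed stub 2)
  choose Dc hDc_cont hDc using fun N : ℕ =>
    Summit.AtomisticToContinuum.FouriersLaw.Theorems.NoiseLocality.stub_responseContinuousInNoise
      ω₂ lam β γ hω hl hβ hγ N T hT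
  have hDc_can : ∀ (N : ℕ) (ε : ℝ), 0 ≤ ε → ε ≤ 1 →
      Tendsto (fun δ : ℝ => (pinnedChain ω₂ lam β γ).totalCurrent
        (μc N ε (T + δ / 2) (T - δ / 2)) / δ) (𝓝[≠] 0) (𝓝 (Dc N ε)) :=
    fun N ε h0 h1' => hDc N ε h0 h1' (μc N ε) (hfam N ε h0 h1')
  -- (2) positivity for `N ≥ 2` (landed stub 3)
  have hpos : ∀ N : ℕ, 2 ≤ N → ∀ ε : ℝ, 0 ≤ ε → ε ≤ 1 → 0 < Dc N ε :=
    fun N hN ε h0 h1' =>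
      Summit.AtomisticToContinuum.FouriersLaw.Theorems.NoiseLocality.stub_positiveNoisyConductance
        ω₂ lam β γ hω hl hβ hγ N hN ε h0 h1' T hT (μc N ε) (hfam N ε h0 h1') (Dc N ε) (hDc_can N ε h0 h1')
  exact ⟨μc, Dc, hfam, hDc_cont, hpos, hDc⟩

/-! ## Composition (sorry-free apart from the two registered stubs): M1⋆ ∧ M2⋆ ⟹ the crux BY NAME -/

/-- **`NoiseLocality_of`** — the skeleton's deciding theorem (v7): `stub_resistanceQuasiMonotoneInLength` (M1⋆) and
`stub_smallNoiseReducesResponseEventually` (M2⋆) imply `VanishingNoiseTransfer.NoiseLocality`.  `canonical_of_three` (landed stubs 1–3) gives the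
canonical responses; (M1⋆)/(M2⋆) instantiated at the canonical families give the tail hypotheses for `r N ε := (Dc N ε)⁻¹`;
`modulus_of_tail_monotone` yields `w`; the crux's own `μ0, με, D0, Dε` are identified with the canonical ones by
uniqueness of limits along `𝓝[≠] 0` (`N ≥ 2`), and `N ≤ 1` is currentless. [folklore] -/
theorem NoiseLocality_of (hM1 : stub_resistanceQuasiMonotoneInLength)
    (hM2 : stub_smallNoiseReducesResponseEventually) :
    Summit.AtomisticToContinuum.FouriersLaw.Theses.VanishingNoiseTransfer.NoiseLocality := by
  intro ω₂ lam β γ hω hl hβ hγ S hS T hT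
  subst hS
  obtain ⟨μc, Dc, hfam, hcont, hpos, hcan⟩ := canonical_of_three hω hl hβ hγ hT
  -- the deterministic canonical family in `IsSteadyState` form
  have hfam0 : ∀ (N : ℕ) (T_L T_R : ℝ), 0 < T_L → 0 < T_R →
      (pinnedChain ω₂ lam β γ).IsSteadyState N T_L T_R (μc N 0 T_L T_R) ∧
        ∀ ν : Measure (PhaseSpace N),
          (pinnedChain ω₂ lam β γ).IsSteadyState N T_L T_R ν → ν = μc N 0 T_L T_R := by
    intro N T_L T_R hL hR
    obtain ⟨h1, h2⟩ := hfam N 0 le_rfl zero_le_one T_L T_R hL hR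
    refine ⟨((pinnedChain ω₂ lam β γ).isFlipSteadyState_zero_iff N T_L T_R _).1 h1, fun ν hν => h2 ν ?_⟩
    exact ((pinnedChain ω₂ lam β γ).isFlipSteadyState_zero_iff N T_L T_R ν).2 hν
  -- the transposed table
  set r : ℕ → ℝ → ℝ := fun N ε => (Dc N ε)⁻¹ with hr
  have hcont' : ∀ N : ℕ, 2 ≤ N → ContinuousOn (r N) (Set.Icc 0 1) :=
    fun N hN => (hcont N).inv₀ fun ε hε => (hpos N hN ε hε.1 hε.2).ne'
  have hpos' : ∀ N : ℕ, 2 ≤ N → ∀ ε : ℝ, 0 ≤ ε → ε ≤ 1 → 0 ≤ r N ε := fun N hN ε hε0 hε1 => by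
    simp only [hr]
    exact (inv_pos.2 (hpos N hN ε hε0 hε1)).le
  -- the two tail stubs at the canonical families
  obtain ⟨N₁, A, hA⟩ := hM1 ω₂ lam β γ hω hl hβ hγ T hT
  obtain ⟨N₂, ε₀, hε₀, hE⟩ := hM2 ω₂ lam β γ hω hl hβ hγ T hT
  set Ns : ℕ := max N₁ N₂ with hNs
  have hmono : ∀ N : ℕ, Ns ≤ N → 2 ≤ N → ∀ ε : ℝ, 0 < ε → ε ≤ 1 →
      r (N + 1) ε ≤ r N ε + A / ((N : ℝ) * ((N : ℝ) - 1)) := by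
    intro N hN hN2 ε hε hε1
    have h := hA N ((le_max_left _ _).trans hN) hN2 ε hε hε1 (μc N ε) (hfam N ε hε.le hε1)
      (μc (N + 1) ε) (hfam (N + 1) ε hε.le hε1) (Dc N ε) (Dc (N + 1) ε)
      (hcan N ε hε.le hε1 (μc N ε) (hfam N ε hε.le hε1))
      (hcan (N + 1) ε hε.le hε1 (μc (N + 1) ε) (hfam (N + 1) ε hε.le hε1))
    simpa only [hr] using h
  have hnoise : ∀ N : ℕ, Ns ≤ N → 2 ≤ N → ∀ ε : ℝ, 0 < ε → ε ≤ min ε₀ 1 → r N 0 ≤ r N ε := by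
    intro N hN hN2 ε hε hε1
    have hεε₀ : ε ≤ ε₀ := hε1.trans (min_le_left _ _)
    have hε1' : ε ≤ 1 := hε1.trans (min_le_right _ _)
    have hle : Dc N ε ≤ Dc N 0 :=
      hE N ((le_max_right _ _).trans hN) hN2 ε hε hεε₀ (μc N 0) (hfam0 N) (μc N ε) (hfam N ε hε.le hε1')
        (Dc N 0) (Dc N ε)
        (hcan N 0 le_rfl zero_le_one (μc N 0) (hfam N 0 le_rfl zero_le_one))
        (hcan N ε hε.le hε1' (μc N ε) (hfam N ε hε.le hε1'))
    simp only [hr]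
    exact inv_anti₀ (hpos N hN2 ε hε.le hε1') hle
  obtain ⟨w, hw, hwb⟩ :=
    modulus_of_tail_monotone r A (min ε₀ 1) Ns (lt_min hε₀ one_pos) hcont' hpos' hmono hnoise
  -- the crux for its own `μ0, με, D0, Dε`
  refine ⟨w, hw, ?_⟩
  intro N ε hε hε1 μ0 με hμ0 hμε D0 Dε hD0 hDε
  by_cases hN : 2 ≤ N
  · have hμ0' : ∀ T_L T_R : ℝ, 0 < T_L → 0 < T_R →
        (pinnedChain ω₂ lam β γ).IsFlipSteadyState N T_L T_R 0 (μ0 T_L T_R) ∧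
          ∀ ν : Measure (PhaseSpace N),
            (pinnedChain ω₂ lam β γ).IsFlipSteadyState N T_L T_R 0 ν → ν = μ0 T_L T_R := by
      intro T_L T_R hL hR
      refine ⟨((pinnedChain ω₂ lam β γ).isFlipSteadyState_zero_iff N T_L T_R _).2 (hμ0 T_L T_R hL hR).1,
        fun ν hν => (hμ0 T_L T_R hL hR).2 ν ?_⟩
      exact ((pinnedChain ω₂ lam β γ).isFlipSteadyState_zero_iff N T_L T_R ν).1 hν
    have hD0eq : D0 = Dc N 0 := tendsto_nhds_unique hD0 (hcan N 0 le_rfl zero_le_one μ0 hμ0')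
    have hDεeq : Dε = Dc N ε := tendsto_nhds_unique hDε (hcan N ε hε.le hε1 με hμε)
    have hD0pos : 0 < D0 := hD0eq ▸ hpos N hN 0 le_rfl zero_le_one
    have hDεpos : 0 < Dε := hDεeq ▸ hpos N hN ε hε.le hε1
    have hb : |Dε⁻¹ - D0⁻¹| ≤ w ε := by
      rw [hD0eq, hDεeq]
      exact hwb N hN ε hε hε1
    have key : D0 - Dε = D0 * Dε * (Dε⁻¹ - D0⁻¹) := by
      rw [mul_sub, mul_assoc, mul_inv_cancel₀ hDεpos.ne', mul_one, mul_comm D0 Dε, mul_assoc,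
        mul_inv_cancel₀ hD0pos.ne', mul_one]
    rw [key, abs_mul, abs_mul]
    calc |D0| * |Dε| * |Dε⁻¹ - D0⁻¹| ≤ |D0| * |Dε| * w ε := by gcongr
      _ = w ε * |D0| * |Dε| := by ring
  · -- `N ≤ 1`: no bond, no current, `D0 = Dε = 0`
    have hN1 : N ≤ 1 := by omega
    have h0 : D0 = 0 :=
      Summit.AtomisticToContinuum.FouriersLaw.Theorems.NoiseLocality.FeketeReduction.response_eq_zero_of_le_one _ hN1 μ0 T D0 hD0
    have hε0 : Dε = 0 :=
      Summit.AtomisticToContinuum.FouriersLaw.Theorems.NoiseLocality.FeketeReduction.response_eq_zero_of_le_one _ hN1 με T Dε hDε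
    simp [h0, hε0]

/-! ## The v5 decomposition stays available (landed, p134698): 4a ∧ 4b ⟹ the crux -/

/-- The alternative (v5) route through the uniform two-sided series law, as landed by lead c1:
`FeketeReduction.noiseLocality_of_zero_of_extensivity` (4a = stmt-14041 ∧ stmt-11748 text, 4b = Matthiessen extensivity text).
Recorded here so that both decompositions of the crux are visible from the skeleton; its hypotheses are NOT registered stubs of v6. -/
theorem NoiseLocality_of_fekete :
    type_of% @Summit.AtomisticToContinuum.FouriersLaw.Theorems.NoiseLocality.FeketeReduction.noiseLocality_of_zero_of_extensivity :=
  @Summit.AtomisticToContinuum.FouriersLaw.Theorems.NoiseLocality.FeketeReduction.noiseLocality_of_zero_of_extensivity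

end Summit.AtomisticToContinuum.FouriersLaw.Cruxes.NoiseLocality.FeketeTransposedUniformity

end
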